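import Mathlib
import Literature.NumberTheory.LFunctions.Zhang2022.Section7aStatements
import HarnessLib

/-!
# Zhang (2022) §7, Proposition 7.1 «Initial steps»: the deduction node `Z22:Prop7.1.pf.a-initial`
# DISCHARGED — (7.3) from the steps §7.u013–u018, (7.4) and (7.5)

Topic `Literature/NumberTheory/LFunctions/Zhang2022` (Landau–Siegel adjudication tree;
verdict-neutral). Y. Zhang, *Discrete mean estimates and the Landau–Siegel zero*,
arXiv:2211.02515v1 (2022) [Zhang2022LandauSiegel] — **an unrefereed manuscript under adjudication**
— §7, proof of Proposition 7.1, «Initial steps» (PDF pp. 34–35, tex L1856–L1910): "First we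
need to prove (7.3) … To handle the sum over `m < P²` we move the path of integration to `𝔍(0)`.
Hence `|∫_{𝔍(1)} 𝒞̃AAω ds| ≤ ∫_{𝔍(0)} |Σ_{m<P²}(κ∗a₁)(m)ψ(m)m^{−s}||A(𝐚₂;1−s,ψ̄)ω(s)ds| + O(ε)`.
By (7.4), the proof of (7.3) is reduced to showing that
`Σ_{ψ∈Ψ₂}|Σ_{m<P²}(κ∗a₁)(m)ψ(m)m^{−s}||A(𝐚₂;1−s,ψ̄)| = o(𝔓)`, `σ = 1/2`. (7.5)"

D-0069 campaign (cell `siegel-zhang`), discharge prover sz-d18. Slice L2-t2's typed deduction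
`Section7aStatements.DedEq73 c′ := Step7u013 → Step7u014 → Step7u015 → Step7u016 → Eq74 →
Step7u017 → Step7u018 → Eq75 → Eq73` — the manuscript's proof of (7.3) from its own steps, as
ONE implication — is PROVED here (`dedEq73_holds`). The proof is the bookkeeping the text leaves
implicit: sum the per-`ψ` inequality of §7.u018 over `ψ ∈ Ψ₂`; exchange the (finite) sum with the
arc-length integral over `𝔍(0)` (the integrands are continuous in the height `v`); bound the inner
sum pointwise on `σ = 1/2` by (7.5) and the remaining `∫_{𝔍(0)}|ω(s)ds|` by (7.4); and absorb the
accumulated `#Ψ₂·O(ε)`, `ε = exp{−c𝓛¹⁰}`, by `#Ψ₂ ≤ #Ψ ≤ Σ_{p∼P} p = 𝔓` (the count of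
characters mod `p`, Montgomery–Vaughan Cor. 4.5; (2.9)). Only §7.u018, (7.4), (7.5) are used;
§7.u013–u017 enter the manuscript's chain upstream of §7.u018 and are carried as the node's stated
antecedents. 0 new facts; nothing about the manuscript's Theorems 1–2 or Landau–Siegel zeros.

## References

* Y. Zhang, arXiv:2211.02515v1 (2022), §7 (7.3)–(7.5) pp. 34–35. [cite: Zhang2022LandauSiegel, §7 (7.3) p.34]
-/

noncomputable section

open Complex Real ComplexConjugate

namespace Literature.NumberTheory.LFunctions.Zhang2022.Section7Eq73Edge

open Finset Skeleton Section7aStatements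

/-! ### Counting `Ψ₂`: `#Ψ₂ ≤ #Ψ ≤ 𝔓` -/

/-- `Ψ` embeds in `Σ_{p∼P} {characters mod p}` (injectivity of `Chr.toSigma`).
[cite: Zhang2022LandauSiegel, §2 p.4] -/
private theorem toSigma_injective (D : ℕ) : Function.Injective (Chr.toSigma (D := D)) := by
  rintro ⟨p, hp, ψ, hψ⟩ ⟨p', hp', ψ', hψ'⟩ h
  simp only [Chr.toSigma, Sigma.mk.injEq, Subtype.mk.injEq] at h
  obtain ⟨rfl, h2⟩ := h
  simp only [heq_eq_eq] at h2
  subst h2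
  rfl

/-- `ℂ` has enough roots of unity for `(ZMod q)ˣ` (so that characters mod `q` can be counted).
[folklore] -/
private theorem hasEnoughRootsOfUnity_zmod (q : ℕ) [NeZero q] :
    HasEnoughRootsOfUnity ℂ (Monoid.exponent (ZMod q)ˣ) := by
  haveI : NeZero ((Monoid.exponent (ZMod q)ˣ : ℕ) : ℂ) :=
    ⟨Nat.cast_ne_zero.mpr Monoid.exponent_ne_zero_of_finite⟩
  infer_instance

/-- There are `φ(q) ≤ q` Dirichlet characters mod `q` (as a `Fintype.card`).
[cite: MontgomeryVaughan2007, §4.2 Cor. 4.5] -/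
private theorem fintype_card_dirichletCharacter_le (q : ℕ) [NeZero q]
    [Fintype (DirichletCharacter ℂ q)] : Fintype.card (DirichletCharacter ℂ q) ≤ q := by
  haveI := hasEnoughRootsOfUnity_zmod q
  rw [← Nat.card_eq_fintype_card, DirichletCharacter,
    MulChar.card_eq_card_units_of_hasEnoughRootsOfUnity (ZMod q) ℂ, Nat.card_eq_fintype_card,
    ZMod.card_units_eq_totient]
  exact Nat.totient_le q

/-- **`#Ψ₂ ≤ 𝔓`**: `#Ψ₂ ≤ #Ψ ≤ Σ_{p∼P} #{characters mod p} = Σ_{p∼P} φ(p) ≤ Σ_{p∼P} p = 𝔓` (the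
absorption of the per-`ψ` error `O(ε)` in (7.3); the twin of `Section8aStatements.cardPsiOneLe_holds`
for `Ψ₁`). [cite: Zhang2022LandauSiegel, §2 (2.9) p.4; §7 (7.3) p.34] -/
theorem card_finsetOf_PsiTwo_le_frakP {D : ℕ} [NeZero D] (χ : DirichletCharacter ℂ D) :
    ((finsetOf (PsiTwo χ)).card : ℝ) ≤ frakP D := by
  classical
  haveI : Fintype (Chr D) := Fintype.ofFinite _
  haveI : ∀ q : primeWindow D, Fintype (DirichletCharacter ℂ (q : ℕ)) := fun q => Fintype.ofFinite _
  have h1 : (finsetOf (PsiTwo χ)).card ≤ Fintype.card (Chr D) := Finset.card_le_univ _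
  have h2 : Fintype.card (Chr D) ≤
      Fintype.card ((q : primeWindow D) × DirichletCharacter ℂ (q : ℕ)) :=
    Fintype.card_le_of_injective _ (toSigma_injective D)
  have h3 : Fintype.card ((q : primeWindow D) × DirichletCharacter ℂ (q : ℕ)) ≤
      ∑ q : primeWindow D, (q : ℕ) := by
    rw [Fintype.card_sigma]
    exact Finset.sum_le_sum fun q _ => fintype_card_dirichletCharacter_le (q : ℕ)
  have h4 : (∑ q : primeWindow D, ((q : ℕ) : ℝ)) = frakP D := by
    rw [frakP_eq_sum_primeWindow, ← Finset.sum_coe_sort (primeWindow D)]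
  calc ((finsetOf (PsiTwo χ)).card : ℝ) ≤ ((∑ q : primeWindow D, (q : ℕ) : ℕ) : ℝ) := by
        exact_mod_cast h1.trans (h2.trans h3)
    _ = frakP D := by rw [← h4]; push_cast; rfl

/-! ### Continuity in the height `v` of the integrands on `𝔍(0)` -/

section Continuity

variable (c' : ℝ) {D : ℕ} (x : Chr D)

/-- The point `s₀ + z + iv` of `𝔍(z)` depends continuously on the height `v`.
[cite: Zhang2022LandauSiegel, §7 p.33, tex L1824] -/
theorem continuous_segPoint (z : ℝ) : Continuous fun v : ℝ => (z : ℂ) + s0 D + v * I := by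
  fun_prop

/-- `ω(s)` is continuous along `𝔍(z)`. [cite: Zhang2022LandauSiegel, §2 (2.15) p.5] -/
theorem continuous_omegaW_seg (z : ℝ) :
    Continuous fun v : ℝ => omegaW D ((z : ℂ) + s0 D + v * I) := by
  unfold omegaW SmoothWeight.omega
  have h := continuous_segPoint (D := D) z
  fun_prop

/-- `Σ_{m<P²}(κ∗a₁)(m)ψ(m)m^{−s}` is continuous along `𝔍(z)` (a finite Dirichlet polynomial,
`m ≥ 1`). [cite: Zhang2022LandauSiegel, §7 (7.5) p.35] -/
theorem continuous_kconvHead_seg (a₁ : ℕ → ℂ) (z : ℝ) :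
    Continuous fun v : ℝ => kconvHead c' x a₁ ((z : ℂ) + s0 D + v * I) := by
  unfold kconvHead
  refine continuous_finsetSum _ fun m hm => ?_
  have hm0 : (m : ℂ) ≠ 0 := by exact_mod_cast Nat.one_le_iff_ne_zero.1 (Finset.mem_Ico.1 hm).1
  have hc : Continuous fun v : ℝ => (m : ℂ) ^ ((z : ℂ) + s0 D + v * I) :=
    (continuous_segPoint (D := D) z).const_cpow (Or.inl hm0)
  exact continuous_const.div hc fun v h => hm0 ((cpow_eq_zero_iff _ _).1 h).1

/-- `A(𝐚₂;1−s,ψ̄)` is continuous along `𝔍(z)` (a finite Dirichlet polynomial; the `n = 0` term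
vanishes since `ψ̄(0) = 0`). [cite: Zhang2022LandauSiegel, §7 p.33, tex L1821] -/
theorem continuous_ApolyBar_seg (a₂ : ℕ → ℂ) (z : ℝ) :
    Continuous fun v : ℝ => ApolyBar x a₂ (1 - ((z : ℂ) + s0 D + v * I)) := by
  have e : ∀ w, ApolyBar x a₂ w =
      ∑ n ∈ Finset.range (Nsupp D), a₂ n * x.ψ⁻¹ (n : ZMod x.p) * (n : ℂ) ^ (-w) := fun w => rfl
  simp only [e]
  refine continuous_finsetSum _ fun n _ => ?_
  rcases Nat.eq_zero_or_pos n with rfl | hn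
  · have h0 : ∀ w : ℂ, a₂ 0 * x.ψ⁻¹ ((0 : ℕ) : ZMod x.p) * ((0 : ℕ) : ℂ) ^ (-w) = 0 := fun w => by
      rw [Nat.cast_zero, MulChar.map_zero, mul_zero, zero_mul]
    simp only [h0]
    exact continuous_const
  · have hn0 : (n : ℂ) ≠ 0 := by exact_mod_cast hn.ne'
    have hw : Continuous fun v : ℝ => -(1 - ((z : ℂ) + s0 D + v * I)) := by fun_prop
    exact continuous_const.mul (hw.const_cpow (Or.inl hn0))

end Continuity

/-! ### The deduction -/

/-- The point `s₀ + iv` of `𝔍(0)` lies on the critical line. [cite: Zhang2022LandauSiegel, §7 (7.5) p.35] -/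
theorem segPoint_zero_re {D : ℕ} (v : ℝ) : (((0 : ℝ) : ℂ) + s0 D + v * I).re = 1 / 2 := by
  simp [s0, SmoothWeight.s0]

/-- **`Z22:Prop7.1.pf.a-initial` DISCHARGED** — the manuscript's proof of (7.3) from its steps, as the
typed implication `DedEq73 c′ : Step7u013 → Step7u014 → Step7u015 → Step7u016 → Eq74 → Step7u017 →
Step7u018 → Eq75 → Eq73`: sum §7.u018 over `ψ ∈ Ψ₂`, exchange the finite sum with `∫_{𝔍(0)}|…ds|`,
bound the inner sum on `σ = 1/2` by (7.5) and `∫_{𝔍(0)}|ω(s)ds|` by (7.4), and absorb `#Ψ₂·O(ε)` by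
`#Ψ₂ ≤ 𝔓`, `ε = exp{−c𝓛¹⁰} = o(1)`. [cite: Zhang2022LandauSiegel, §7 (7.3)–(7.5) pp.34–35, tex L1856–L1910] -/
theorem dedEq73_holds (c' : ℝ) : DedEq73 c' := by
  intro _ _ _ _ h74 _ h18 h75 B ε hε
  obtain ⟨C₇₄, D₁, H74⟩ := h74
  obtain ⟨c, hc, C₁₈, D₂, H18⟩ := h18 B
  set K : ℝ := max C₇₄ 1 with hKdef
  have hK : 0 < K := lt_of_lt_of_le zero_lt_one (le_max_right _ _)
  have hε' : 0 < ε / (2 * K) := by positivity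
  obtain ⟨D₃, H75⟩ := h75 B (ε / (2 * K)) hε'
  -- `D₄`: `𝓛 ≥ 1` and `(|C₁₈| + 1)·exp(−c𝓛¹⁰) ≤ ε/2`
  set M : ℝ := max 1 (Real.log (2 * (|C₁₈| + 1) / ε) / c) with hMdef
  obtain ⟨D₄, H4⟩ : ∃ D₄ : ℕ, ∀ D : ℕ, D₄ ≤ D → M ≤ ell D := by
    refine ⟨⌈Real.exp M⌉₊ + 1, fun D hD => ?_⟩
    have hD' : (⌈Real.exp M⌉₊ : ℝ) ≤ D := by exact_mod_cast (by omega : ⌈Real.exp M⌉₊ ≤ D)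
    have h1 : Real.exp M ≤ D := le_trans (Nat.le_ceil _) hD'
    exact (Real.le_log_iff_exp_le (lt_of_lt_of_le (Real.exp_pos M) h1)).2 h1
  refine ⟨max (max D₁ D₂) (max D₃ D₄), fun D _ χ hD hq hp hA a₁ a₂ ha₁ ha₂ => ?_⟩
  have hD1 : D₁ ≤ D := le_trans (le_trans (le_max_left _ _) (le_max_left _ _)) hD
  have hD2 : D₂ ≤ D := le_trans (le_trans (le_max_right _ _) (le_max_left _ _)) hD
  have hD3 : D₃ ≤ D := le_trans (le_trans (le_max_left _ _) (le_max_right _ _)) hD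
  have hD4 : D₄ ≤ D := le_trans (le_trans (le_max_right _ _) (le_max_right _ _)) hD
  have hM := H4 D hD4
  have hL1 : 1 ≤ ell D := le_trans (le_max_left _ _) hM
  -- notation
  set S := finsetOf (PsiTwo χ) with hSdef
  set e : ℝ := Real.exp (-c * ell D ^ 10) with hedef
  have he : 0 < e := Real.exp_pos _
  have hfrakP : 0 ≤ frakP D := le_trans (Nat.cast_nonneg _) (card_finsetOf_PsiTwo_le_frakP χ)
  -- §7.u018 for each `ψ`
  have h18x : ∀ x : Chr D, ‖intJ D 1 (mvIntegrand c' x a₁ a₂)‖ ≤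
      absIntJ D 0 (fun s => kconvHead c' x a₁ s * (ApolyBar x a₂ (1 - s) * omegaW D s)) +
        C₁₈ * e := fun x => H18 D χ hD2 hq hp x a₁ a₂ ha₁ ha₂
  -- integrability on `𝔍(0)`
  have hω : Continuous fun v : ℝ => ‖omegaW D (((0 : ℝ) : ℂ) + s0 D + v * I)‖ :=
    (continuous_omegaW_seg (D := D) 0).norm
  have hG : ∀ x : Chr D, Continuous fun v : ℝ =>
      ‖kconvHead c' x a₁ (((0 : ℝ) : ℂ) + s0 D + v * I) *
        (ApolyBar x a₂ (1 - (((0 : ℝ) : ℂ) + s0 D + v * I)) *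
          omegaW D (((0 : ℝ) : ℂ) + s0 D + v * I))‖ := fun x =>
    ((continuous_kconvHead_seg c' x a₁ 0).mul
      ((continuous_ApolyBar_seg x a₂ 0).mul (continuous_omegaW_seg (D := D) 0))).norm
  have hℓ : -ell1 D ≤ ell1 D := by
    have : 0 ≤ ell1 D := pow_nonneg (le_trans zero_le_one hL1) _
    linarith
  -- the sum of the `𝔍(0)`-integrals
  have hmain : ∑ x ∈ S, absIntJ D 0
      (fun s => kconvHead c' x a₁ s * (ApolyBar x a₂ (1 - s) * omegaW D s)) ≤
        ε / (2 * K) * frakP D * C₇₄ := by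
    have hswap : ∑ x ∈ S, absIntJ D 0
        (fun s => kconvHead c' x a₁ s * (ApolyBar x a₂ (1 - s) * omegaW D s)) =
          ∫ v in (-ell1 D)..ell1 D, ∑ x ∈ S,
            ‖kconvHead c' x a₁ (((0 : ℝ) : ℂ) + s0 D + v * I) *
              (ApolyBar x a₂ (1 - (((0 : ℝ) : ℂ) + s0 D + v * I)) *
                omegaW D (((0 : ℝ) : ℂ) + s0 D + v * I))‖ := by
      rw [intervalIntegral.integral_finsetSum fun x _ => (hG x).intervalIntegrable _ _]
      rfl
    rw [hswap]
    have hpt : ∀ v : ℝ, ∑ x ∈ S,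
        ‖kconvHead c' x a₁ (((0 : ℝ) : ℂ) + s0 D + v * I) *
          (ApolyBar x a₂ (1 - (((0 : ℝ) : ℂ) + s0 D + v * I)) *
            omegaW D (((0 : ℝ) : ℂ) + s0 D + v * I))‖ ≤
        ε / (2 * K) * frakP D * ‖omegaW D (((0 : ℝ) : ℂ) + s0 D + v * I)‖ := by
      intro v
      have h := H75 D χ hD3 hq hp hA a₁ a₂ ha₁ ha₂ _ (segPoint_zero_re (D := D) v)
      have e1 : ∑ x ∈ S,
          ‖kconvHead c' x a₁ (((0 : ℝ) : ℂ) + s0 D + v * I) *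
            (ApolyBar x a₂ (1 - (((0 : ℝ) : ℂ) + s0 D + v * I)) *
              omegaW D (((0 : ℝ) : ℂ) + s0 D + v * I))‖ =
          (∑ x ∈ S, ‖kconvHead c' x a₁ (((0 : ℝ) : ℂ) + s0 D + v * I)‖ *
            ‖ApolyBar x a₂ (1 - (((0 : ℝ) : ℂ) + s0 D + v * I))‖) *
            ‖omegaW D (((0 : ℝ) : ℂ) + s0 D + v * I)‖ := by
        rw [Finset.sum_mul]
        exact Finset.sum_congr rfl fun x _ => by rw [norm_mul, norm_mul, mul_assoc]
      rw [e1]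
      exact mul_le_mul_of_nonneg_right h (norm_nonneg _)
    calc ∫ v in (-ell1 D)..ell1 D, ∑ x ∈ S,
          ‖kconvHead c' x a₁ (((0 : ℝ) : ℂ) + s0 D + v * I) *
            (ApolyBar x a₂ (1 - (((0 : ℝ) : ℂ) + s0 D + v * I)) *
              omegaW D (((0 : ℝ) : ℂ) + s0 D + v * I))‖
        ≤ ∫ v in (-ell1 D)..ell1 D,
            ε / (2 * K) * frakP D * ‖omegaW D (((0 : ℝ) : ℂ) + s0 D + v * I)‖ :=
          intervalIntegral.integral_mono_on hℓ
            ((continuous_finsetSum _ fun x _ => hG x).intervalIntegrable _ _)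
            ((continuous_const.mul hω).intervalIntegrable _ _) (fun v _ => hpt v)
      _ = ε / (2 * K) * frakP D * absIntJ D 0 (omegaW D) := by
          rw [intervalIntegral.integral_const_mul]; rfl
      _ ≤ ε / (2 * K) * frakP D * C₇₄ :=
          mul_le_mul_of_nonneg_left (H74 D χ hD1 hq hp 0 (by
            rw [abs_zero]; exact pow_nonneg (le_trans zero_le_one hL1) 9)) (by positivity)
  -- the accumulated `#Ψ₂·O(ε)`
  have hcount : (S.card : ℝ) * (C₁₈ * e) ≤ frakP D * ((|C₁₈| + 1) * e) :=
    calc (S.card : ℝ) * (C₁₈ * e) ≤ (S.card : ℝ) * ((|C₁₈| + 1) * e) :=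
          mul_le_mul_of_nonneg_left
            (mul_le_mul_of_nonneg_right (by linarith [le_abs_self C₁₈]) he.le) (Nat.cast_nonneg _)
      _ ≤ frakP D * ((|C₁₈| + 1) * e) :=
          mul_le_mul_of_nonneg_right (card_finsetOf_PsiTwo_le_frakP χ) (by positivity)
  have hsmall : (|C₁₈| + 1) * e ≤ ε / 2 := by
    have hc18 : 0 < |C₁₈| + 1 := by positivity
    have hlog : Real.log (2 * (|C₁₈| + 1) / ε) / c ≤ ell D := le_trans (le_max_right _ _) hM
    have h10 : ell D ≤ ell D ^ 10 := le_self_pow₀ hL1 (by norm_num)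
    have h1 : Real.log (2 * (|C₁₈| + 1) / ε) ≤ c * ell D ^ 10 := by
      have := (div_le_iff₀ hc).1 hlog
      nlinarith
    have h2 : e ≤ ε / (2 * (|C₁₈| + 1)) := by
      rw [hedef, ← Real.exp_log (by positivity : (0 : ℝ) < ε / (2 * (|C₁₈| + 1)))]
      apply Real.exp_le_exp.2
      have : Real.log (ε / (2 * (|C₁₈| + 1))) = -Real.log (2 * (|C₁₈| + 1) / ε) := by
        rw [← Real.log_inv, inv_div]
      rw [this]
      linarith
    calc (|C₁₈| + 1) * e ≤ (|C₁₈| + 1) * (ε / (2 * (|C₁₈| + 1))) :=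
          mul_le_mul_of_nonneg_left h2 hc18.le
      _ = ε / 2 := by field_simp
  -- assemble
  have hKC : C₇₄ ≤ K := le_max_left _ _
  calc ‖∑ x ∈ S, intJ D 1 (mvIntegrand c' x a₁ a₂)‖
      ≤ ∑ x ∈ S, ‖intJ D 1 (mvIntegrand c' x a₁ a₂)‖ := norm_sum_le _ _
    _ ≤ ∑ x ∈ S, (absIntJ D 0
          (fun s => kconvHead c' x a₁ s * (ApolyBar x a₂ (1 - s) * omegaW D s)) + C₁₈ * e) :=
        Finset.sum_le_sum fun x _ => h18x x
    _ = ∑ x ∈ S, absIntJ D 0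
          (fun s => kconvHead c' x a₁ s * (ApolyBar x a₂ (1 - s) * omegaW D s)) +
          (S.card : ℝ) * (C₁₈ * e) := by
        rw [Finset.sum_add_distrib, Finset.sum_const, nsmul_eq_mul]
    _ ≤ ε / (2 * K) * frakP D * C₇₄ + frakP D * ((|C₁₈| + 1) * e) := add_le_add hmain hcount
    _ ≤ ε / (2 * K) * frakP D * K + frakP D * (ε / 2) :=
        add_le_add (mul_le_mul_of_nonneg_left hKC (by positivity))
          (mul_le_mul_of_nonneg_left hsmall hfrakP)
    _ = ε * frakP D := by field_simp; ring

variable (c' : ℝ) in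
/-- `DedEq73` — `_holds` alias of `dedEq73_holds` above under the fact's exact name, stated under the
prover's own binders as section variables (appended 2026-08-28, D-0026 bookkeeping: the proof term is the
existing theorem of this file; no statement, definition or attribute is edited; no new named fact; the
ledger's debt table listed the fact unproved). [cite: Zhang2022LandauSiegel, §7 (7.3)–(7.5) pp.34–35, tex L1856–L1910] -/
theorem _root_.Literature.NumberTheory.LFunctions.Zhang2022.Section7aStatements.DedEq73_holds :
    _root_.Literature.NumberTheory.LFunctions.Zhang2022.Section7aStatements.DedEq73 c' :=
  _root_.Literature.NumberTheory.LFunctions.Zhang2022.Section7Eq73Edge.dedEq73_holds (c' := c')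

end Literature.NumberTheory.LFunctions.Zhang2022.Section7Eq73Edge
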